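import Summits.Parity.BatemanHorn.Theses.AlmostPrimeZeros

/-!
# Crux `DiscMajorantLog` (stmt-Parity-17114), line `Sketch`: stub `stub_finZero` (the row `k = 0`)

Support lemma `stub_finZero` (a registered stub of the line skeleton
`Cruxes/DiscMajorantLog/Lines/Sketch.lean`): the degenerate calibration row `k = 0` of the Γ-budget
disc majorant `‖S_x(z)‖ ≤ A·x·(log x)^{k(Re z − 1)}·exp(C‖z−1‖ log(‖z−1‖+2))` for the almost-prime
generating polynomial `S_x(z) = Σ_{0 ≤ n ≤ x} z^{s_f(n)}` of a Bateman–Horn system `f` of `k`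
polynomials.

Mathematics (folklore bookkeeping): for the empty system `f : Fin 0 → ℤ[X]` the exponent
`s_f(n) = Σ_{i : Fin 0} …` is `0`, so every term is `z ^ 0 = 1` and `S_x(z) = x + 1`; on the right,
with `A = 2`, `C = 0`, `x₀ = 1`, the majorant is `2·x·(log x)^0·exp 0 = 2x ≥ x + 1` for `x ≥ 1`.
The hypothesis `IsBatemanHornSystem f` and the disc constraint are not used.

No definitions are introduced; only Mathlib lemmas are used.
-/

noncomputable section

namespace Summit.Parity.BatemanHorn.Cruxes.DiscMajorantLog.Sketch

/-- **Row `k = 0` of the disc majorant.**  For the empty Bateman–Horn system the statistic `s_f` is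
identically `0`, `S_x(z) = x + 1`, and the majorant holds with `A = 2`, `C = 0`, `x₀ = 1`
(`x + 1 ≤ 2x = 2·x·(log x)^{0·(Re z − 1)}·exp 0` for `x ≥ 1`). [folklore] -/
theorem stub_finZero :
    ∀ (f : Fin 0 → Polynomial ℤ), Literature.NumberTheory.Sieve.IsBatemanHornSystem f →
      ∃ A C : ℝ, ∃ x₀ : ℕ, ∀ x : ℕ, x₀ ≤ x → ∀ z : ℂ, ‖z - 1‖ ≤ 3 * Real.log (Real.log (x : ℝ)) →
        ‖(∑ n ∈ Finset.range (x + 1), (z : ℂ) ^ (∑ i, (((f i).eval (n : ℤ)).toNat.factorization.sum fun _ v => min v 2)))‖ ≤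
          A * (x : ℝ) * (Real.log (x : ℝ)) ^ (((0 : ℕ) : ℝ) * ((z : ℂ).re - 1)) *
            Real.exp (C * ‖(z : ℂ) - 1‖ * Real.log (‖(z : ℂ) - 1‖ + 2)) := by
  intro f _
  refine ⟨2, 0, 1, fun x hx z _ => ?_⟩
  have hx' : (1 : ℝ) ≤ (x : ℝ) := by exact_mod_cast hx
  simp only [Finset.univ_eq_empty, Finset.sum_empty, pow_zero, Finset.sum_const, Finset.card_range,
    nsmul_eq_mul, mul_one, Nat.cast_zero, zero_mul, Real.rpow_zero, Real.exp_zero]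
  rw [Complex.norm_natCast]
  push_cast
  linarith

end Summit.Parity.BatemanHorn.Cruxes.DiscMajorantLog.Sketch

end
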